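import Literature.NumberTheory.Sieve.CFSemigroupEigenfunction
import HarnessLib

/-!
# An eigenmeasure of the transfer operator of `Γ_A` (Ruelle–Perron–Frobenius, dual existence)

Support file (all results proved) for the named fact
`Literature.NumberTheory.Sieve.MageeOhWinter2019_uniformCounting` (`CFSemigroupCounting.lean`).
[MageeOhWinter2019, Thm. 10 (Ruelle–Perron–Frobenius), (1)]: "There is a unique probability
measure `ν_f` on `K` such that `L_f*(ν_f) = e^{P(f)} ν_f`." For the transfer operator `L_s` of the
continued fractions semigroup (`cfTransfer`) and `λ_s = e^{P_A(s)}` (`cfEig`) we PROVE the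
existence statement on the unit interval:

* `exists_cfTransfer_eigenmeasure`: for `s ≥ 0` there is a nonzero finite (regular Borel) measure
  `ν` on `[0,1]` with `∫ L_s f dν = λ_s ∫ f dν` for every continuous `f` on `[0,1]`.

Construction (Krylov–Bogolyubov for the dual operator): the functional
`Λ(f) = LIM_N N⁻¹ Σ_{n<N} λ^{-n} (L_sⁿ f)(0)`, with `LIM` a generalised (ultrafilter) limit
(`cfUlim`), is positive, linear, bounded by the Gibbs bounds `λ^{-n} L_sⁿ 1 ≤ 4^s`
(`CFSemigroupEigenfunction.lean`), satisfies `Λ(L_s f) = λ Λ(f)` (the Cesàro defect is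
`O(1/N)`) and `Λ(1) ≥ 4^{-s}`; the Riesz–Markov–Kakutani theorem (Mathlib `RealRMK.rieszMeasure`)
represents it by a measure. (Uniqueness of `ν` is not treated.)

## References

* M. Magee, H. Oh, D. Winter, J. reine angew. Math. 753 (2019) 89–135, Thm. 10 (1).
  [MageeOhWinter2019]
* W. Parry, M. Pollicott, Astérisque 187–188 (1990), Thm. 2.2.
-/

noncomputable section

open Filter Set MeasureTheory CompactlySupported
open scoped Topology Classical

namespace Literature.NumberTheory.Sieve

/-! ### Generalised limits of bounded sequences -/

/-- A generalised limit: the limit along the hyperfilter of `ℕ` when it exists (it does for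
bounded sequences), `0` otherwise. [folklore] -/
def cfUlim (u : ℕ → ℝ) : ℝ :=
  if h : ∃ l : ℝ, Tendsto u (hyperfilter ℕ : Filter ℕ) (𝓝 l) then h.choose else 0

/-- Bounded sequences converge along the hyperfilter to their generalised limit. [folklore] -/
theorem tendsto_cfUlim {u : ℕ → ℝ} {M : ℝ} (hM : ∀ n, |u n| ≤ M) :
    Tendsto u (hyperfilter ℕ : Filter ℕ) (𝓝 (cfUlim u)) := by
  have hex : ∃ l : ℝ, Tendsto u (hyperfilter ℕ : Filter ℕ) (𝓝 l) := by
    have hmem : Icc (-M) M ∈ (hyperfilter ℕ).map u := by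
      rw [Ultrafilter.mem_map]
      exact univ_mem' fun n => abs_le.1 (hM n)
    obtain ⟨l, -, hl⟩ := isCompact_Icc.ultrafilter_le_nhds' _ hmem
    exact ⟨l, hl⟩
  rw [cfUlim, dif_pos hex]
  exact hex.choose_spec

/-- The generalised limit is the limit along the hyperfilter, when there is one. [folklore] -/
theorem cfUlim_eq_of_tendsto {u : ℕ → ℝ} {l : ℝ} (h : Tendsto u (hyperfilter ℕ : Filter ℕ) (𝓝 l)) :
    cfUlim u = l := by
  have hex : ∃ l : ℝ, Tendsto u (hyperfilter ℕ : Filter ℕ) (𝓝 l) := ⟨l, h⟩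
  rw [cfUlim, dif_pos hex]
  exact tendsto_nhds_unique hex.choose_spec h

/-- The generalised limit extends the ordinary limit. [folklore] -/
theorem cfUlim_eq_of_tendsto_atTop {u : ℕ → ℝ} {l : ℝ} (h : Tendsto u atTop (𝓝 l)) :
    cfUlim u = l :=
  cfUlim_eq_of_tendsto (h.mono_left Nat.hyperfilter_le_atTop)

/-- Additivity on bounded sequences. [folklore] -/
theorem cfUlim_add {u v : ℕ → ℝ} {M M' : ℝ} (hu : ∀ n, |u n| ≤ M) (hv : ∀ n, |v n| ≤ M') :
    cfUlim (fun n => u n + v n) = cfUlim u + cfUlim v :=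
  cfUlim_eq_of_tendsto ((tendsto_cfUlim hu).add (tendsto_cfUlim hv))

/-- Homogeneity on bounded sequences. [folklore] -/
theorem cfUlim_const_mul {u : ℕ → ℝ} {M : ℝ} (hu : ∀ n, |u n| ≤ M) (c : ℝ) :
    cfUlim (fun n => c * u n) = c * cfUlim u :=
  cfUlim_eq_of_tendsto ((tendsto_cfUlim hu).const_mul c)

/-- Lower bounds pass to the generalised limit. [folklore] -/
theorem le_cfUlim {u : ℕ → ℝ} {M c : ℝ} (hu : ∀ n, |u n| ≤ M) (h : ∀ n, c ≤ u n) : c ≤ cfUlim u :=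
  ge_of_tendsto' (tendsto_cfUlim hu) h

/-- Upper bounds pass to the generalised limit. [folklore] -/
theorem cfUlim_le {u : ℕ → ℝ} {M c : ℝ} (hu : ∀ n, |u n| ≤ M) (h : ∀ n, u n ≤ c) : cfUlim u ≤ c :=
  le_of_tendsto' (tendsto_cfUlim hu) h

/-! ### The transfer operator on functions on `[0,1]`: iterates, bounds, linearity -/

variable {A : Finset ℕ}

/-- The word sums only see the values of the function on `[0,1]`. [folklore] -/
theorem cfTransferSum_congr (hA : ∀ a ∈ A, 1 ≤ a) (s : ℝ) (n : ℕ) {g g' : ℝ → ℝ}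
    (h : ∀ y ∈ Icc (0 : ℝ) 1, g y = g' y) {x : ℝ} (hx : x ∈ Icc (0 : ℝ) 1) :
    cfTransferSum A s n g x = cfTransferSum A s n g' x := by
  unfold cfTransferSum
  exact Finset.sum_congr rfl fun w _ => by rw [h _ (cfMoeb_cfMat_mem (one_le_coe_digit hA w) hx)]

/-- The iterates only see the values of the function on `[0,1]`. [folklore] -/
theorem cfTransfer_iterate_congr (hA : ∀ a ∈ A, 1 ≤ a) (s : ℝ) (n : ℕ) {g g' : ℝ → ℝ}
    (h : ∀ y ∈ Icc (0 : ℝ) 1, g y = g' y) {x : ℝ} (hx : x ∈ Icc (0 : ℝ) 1) :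
    (cfTransfer A s)^[n] g x = (cfTransfer A s)^[n] g' x := by
  rw [cfTransfer_iterate hA s g n hx, cfTransfer_iterate hA s g' n hx, cfTransferSum_congr hA s n h hx]

/-- Additivity of the iterates on `[0,1]`. [folklore] -/
theorem cfTransfer_iterate_add (hA : ∀ a ∈ A, 1 ≤ a) (s : ℝ) (n : ℕ) (g g' : ℝ → ℝ) {x : ℝ}
    (hx : x ∈ Icc (0 : ℝ) 1) :
    (cfTransfer A s)^[n] (fun y => g y + g' y) x = (cfTransfer A s)^[n] g x + (cfTransfer A s)^[n] g' x := by
  rw [cfTransfer_iterate hA s _ n hx, cfTransfer_iterate hA s g n hx, cfTransfer_iterate hA s g' n hx]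
  simp only [cfTransferSum, mul_add, Finset.sum_add_distrib]

/-- Homogeneity of the iterates on `[0,1]`. [folklore] -/
theorem cfTransfer_iterate_const_mul (hA : ∀ a ∈ A, 1 ≤ a) (s : ℝ) (n : ℕ) (c : ℝ) (g : ℝ → ℝ)
    {x : ℝ} (hx : x ∈ Icc (0 : ℝ) 1) :
    (cfTransfer A s)^[n] (fun y => c * g y) x = c * (cfTransfer A s)^[n] g x := by
  rw [cfTransfer_iterate hA s _ n hx, cfTransfer_iterate hA s g n hx]
  simp only [cfTransferSum, Finset.mul_sum]
  exact Finset.sum_congr rfl fun w _ => by ring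

/-- **Positivity of the iterates:** `g ≥ 0` on `[0,1]` implies `L_sⁿ g ≥ 0` on `[0,1]`. [folklore] -/
theorem cfTransfer_iterate_nonneg (hA : ∀ a ∈ A, 1 ≤ a) (s : ℝ) (n : ℕ) {g : ℝ → ℝ}
    (hg : ∀ y ∈ Icc (0 : ℝ) 1, 0 ≤ g y) {x : ℝ} (hx : x ∈ Icc (0 : ℝ) 1) :
    0 ≤ (cfTransfer A s)^[n] g x := by
  rw [cfTransfer_iterate hA s g n hx, cfTransferSum]
  exact Finset.sum_nonneg fun w _ => mul_nonneg (Real.rpow_nonneg (sq_nonneg _) _)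
    (hg _ (cfMoeb_cfMat_mem (one_le_coe_digit hA w) hx))

/-- **Boundedness of the iterates:** `|g| ≤ M` on `[0,1]` implies `|L_sⁿ g| ≤ M L_sⁿ 1` on `[0,1]`.
[folklore] -/
theorem abs_cfTransfer_iterate_le (hA : ∀ a ∈ A, 1 ≤ a) (s : ℝ) (n : ℕ) {g : ℝ → ℝ} {M : ℝ}
    (hg : ∀ y ∈ Icc (0 : ℝ) 1, |g y| ≤ M) {x : ℝ} (hx : x ∈ Icc (0 : ℝ) 1) :
    |(cfTransfer A s)^[n] g x| ≤ M * (cfTransfer A s)^[n] (fun _ => 1) x := by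
  rw [cfTransfer_iterate hA s g n hx, cfTransfer_iterate hA s _ n hx, cfTransferSum, cfTransferSum,
    Finset.mul_sum]
  refine (Finset.abs_sum_le_sum_abs _ _).trans (Finset.sum_le_sum fun w _ => ?_)
  have hwt : 0 ≤ ((cfDenom (cfMat fun i => (w i : ℕ)) x) ^ 2) ^ (-s) := Real.rpow_nonneg (sq_nonneg _) _
  rw [abs_mul, abs_of_nonneg hwt, mul_one, mul_comm M]
  exact mul_le_mul_of_nonneg_left (hg _ (cfMoeb_cfMat_mem (one_le_coe_digit hA w) hx)) hwt

/-! ### The Cesàro functionals -/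

variable (A) in
/-- The Cesàro averages `N ↦ (N+1)⁻¹ Σ_{n ≤ N} λ^{-n} (L_sⁿ g)(0)`. [folklore] -/
def cfAvg (s : ℝ) (g : ℝ → ℝ) (N : ℕ) : ℝ :=
  (∑ n ∈ Finset.range (N + 1), (cfTransfer A s)^[n] g 0 / cfEig A s ^ n) / (N + 1)

section Avg

variable (hA : ∀ a ∈ A, 1 ≤ a)
include hA

/-- **Uniform bound:** `|g| ≤ M` on `[0,1]` implies `|cfAvg g N| ≤ 4^s M`. [folklore] -/
theorem abs_cfAvg_le (hne : A.Nonempty) {s : ℝ} (hs : 0 ≤ s) {g : ℝ → ℝ} {M : ℝ} (hg : ∀ y ∈ Icc (0 : ℝ) 1, |g y| ≤ M)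
    (N : ℕ) : |cfAvg A s g N| ≤ (4 : ℝ) ^ s * M := by
  have hM : 0 ≤ M := (abs_nonneg _).trans (hg 0 unitInterval.zero_mem)
  have hterm : ∀ n : ℕ, |(cfTransfer A s)^[n] g 0 / cfEig A s ^ n| ≤ (4 : ℝ) ^ s * M := by
    intro n
    have hlam : 0 < cfEig A s ^ n := pow_pos (cfEig_pos s) n
    have h1 := abs_cfTransfer_iterate_le hA s n hg unitInterval.zero_mem
    have h2 := (cfTransfer_iterate_one_div_mem hA hne hs n unitInterval.zero_mem).2
    rw [abs_div, abs_of_pos hlam, div_le_iff₀ hlam]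
    rw [div_le_iff₀ hlam] at h2
    nlinarith
  have hN : (0 : ℝ) < N + 1 := by positivity
  rw [cfAvg, abs_div, abs_of_pos hN, div_le_iff₀ hN]
  calc |∑ n ∈ Finset.range (N + 1), (cfTransfer A s)^[n] g 0 / cfEig A s ^ n|
      ≤ ∑ n ∈ Finset.range (N + 1), |(cfTransfer A s)^[n] g 0 / cfEig A s ^ n| :=
        Finset.abs_sum_le_sum_abs _ _
    _ ≤ ∑ _n ∈ Finset.range (N + 1), (4 : ℝ) ^ s * M := Finset.sum_le_sum fun n _ => hterm n
    _ = (4 : ℝ) ^ s * M * (N + 1) := by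
        rw [Finset.sum_const, Finset.card_range, nsmul_eq_mul]; push_cast; ring

/-- Additivity of the Cesàro averages. [folklore] -/
theorem cfAvg_add (s : ℝ) (g g' : ℝ → ℝ) (N : ℕ) :
    cfAvg A s (fun y => g y + g' y) N = cfAvg A s g N + cfAvg A s g' N := by
  simp only [cfAvg, cfTransfer_iterate_add hA s _ g g' unitInterval.zero_mem, add_div,
    Finset.sum_add_distrib]

/-- Homogeneity of the Cesàro averages. [folklore] -/
theorem cfAvg_const_mul (s c : ℝ) (g : ℝ → ℝ) (N : ℕ) :
    cfAvg A s (fun y => c * g y) N = c * cfAvg A s g N := by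
  simp only [cfAvg, cfTransfer_iterate_const_mul hA s _ c g unitInterval.zero_mem, mul_div_assoc,
    ← Finset.mul_sum]

/-- Positivity of the Cesàro averages. [folklore] -/
theorem cfAvg_nonneg (s : ℝ) {g : ℝ → ℝ} (hg : ∀ y ∈ Icc (0 : ℝ) 1, 0 ≤ g y) (N : ℕ) :
    0 ≤ cfAvg A s g N :=
  div_nonneg (Finset.sum_nonneg fun n _ => div_nonneg
    (cfTransfer_iterate_nonneg hA s n hg unitInterval.zero_mem) (pow_pos (cfEig_pos s) n).le)
    (by positivity)

/-- The Cesàro averages only see the values on `[0,1]`. [folklore] -/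
theorem cfAvg_congr (s : ℝ) {g g' : ℝ → ℝ} (h : ∀ y ∈ Icc (0 : ℝ) 1, g y = g' y) (N : ℕ) :
    cfAvg A s g N = cfAvg A s g' N := by
  simp only [cfAvg, cfTransfer_iterate_congr hA s _ h unitInterval.zero_mem]

/-- The Cesàro averages of `1` are `≥ 4^{-s}`. [folklore] -/
theorem le_cfAvg_one (hne : A.Nonempty) {s : ℝ} (hs : 0 ≤ s) (N : ℕ) : (4 : ℝ) ^ (-s) ≤ cfAvg A s (fun _ => 1) N := by
  have hN : (0 : ℝ) < N + 1 := by positivity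
  rw [cfAvg, le_div_iff₀ hN]
  calc (4 : ℝ) ^ (-s) * (N + 1) = ∑ _n ∈ Finset.range (N + 1), (4 : ℝ) ^ (-s) := by
        rw [Finset.sum_const, Finset.card_range, nsmul_eq_mul]; push_cast; ring
    _ ≤ _ := Finset.sum_le_sum fun n _ =>
        (cfTransfer_iterate_one_div_mem hA hne hs n unitInterval.zero_mem).1

omit hA in
/-- **The Cesàro defect:** `cfAvg (L_s g) N = λ cfAvg g N + λ (λ^{-(N+1)} L_s^{N+1} g(0) - g(0))/(N+1)`.
[folklore] -/
theorem cfAvg_cfTransfer (s : ℝ) (g : ℝ → ℝ) (N : ℕ) :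
    cfAvg A s (cfTransfer A s g) N = cfEig A s * cfAvg A s g N +
      cfEig A s * ((cfTransfer A s)^[N + 1] g 0 / cfEig A s ^ (N + 1) - g 0) / (N + 1) := by
  have hlam := cfEig_pos (A := A) s
  simp only [cfAvg]
  have hshift : ∀ n : ℕ, (cfTransfer A s)^[n] (cfTransfer A s g) 0 = (cfTransfer A s)^[n + 1] g 0 :=
    fun n => (Function.iterate_succ_apply (cfTransfer A s) n g).symm ▸ rfl
  simp only [hshift]
  set a : ℕ → ℝ := fun n => (cfTransfer A s)^[n] g 0 with ha
  have e1 : ∑ n ∈ Finset.range (N + 1), a (n + 1) / cfEig A s ^ n =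
      cfEig A s * ∑ n ∈ Finset.range (N + 1), a (n + 1) / cfEig A s ^ (n + 1) := by
    rw [Finset.mul_sum]
    refine Finset.sum_congr rfl fun n _ => ?_
    rw [pow_succ]
    field_simp
  have tel : ∑ n ∈ Finset.range (N + 1), a (n + 1) / cfEig A s ^ (n + 1) =
      ∑ n ∈ Finset.range (N + 1), a n / cfEig A s ^ n + (a (N + 1) / cfEig A s ^ (N + 1) - a 0) := by
    have h1 := Finset.sum_range_succ' (fun n => a n / cfEig A s ^ n) (N + 1)
    have h2 := Finset.sum_range_succ (fun n => a n / cfEig A s ^ n) (N + 1)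
    simp only [pow_zero, div_one] at h1
    linarith
  have h0 : a 0 = g 0 := by simp [ha]
  rw [e1, tel, h0]
  field_simp
  ring

/-- **The Cesàro defect is small:** for `|g| ≤ M` on `[0,1]` (`s ≥ 0`),
`|cfAvg (L_s g) N - λ cfAvg g N| ≤ λ (4^s + 1) M/(N+1)`. [folklore] -/
theorem abs_cfAvg_cfTransfer_sub_le (hne : A.Nonempty) {s : ℝ} (hs : 0 ≤ s) {g : ℝ → ℝ} {M : ℝ}
    (hg : ∀ y ∈ Icc (0 : ℝ) 1, |g y| ≤ M) (N : ℕ) :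
    |cfAvg A s (cfTransfer A s g) N - cfEig A s * cfAvg A s g N| ≤
      cfEig A s * (((4 : ℝ) ^ s + 1) * M) / (N + 1) := by
  have hlam := cfEig_pos (A := A) s
  have hN : (0 : ℝ) < N + 1 := by positivity
  have hM : 0 ≤ M := (abs_nonneg _).trans (hg 0 unitInterval.zero_mem)
  rw [cfAvg_cfTransfer, add_sub_cancel_left, abs_div, abs_of_pos hN, abs_mul, abs_of_pos hlam]
  refine div_le_div_of_nonneg_right (mul_le_mul_of_nonneg_left ?_ hlam.le) hN.le
  have h1 : |(cfTransfer A s)^[N + 1] g 0 / cfEig A s ^ (N + 1)| ≤ (4 : ℝ) ^ s * M := by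
    have hlam' : 0 < cfEig A s ^ (N + 1) := pow_pos hlam _
    have ha := abs_cfTransfer_iterate_le hA s (N + 1) hg unitInterval.zero_mem
    have hb := (cfTransfer_iterate_one_div_mem hA hne hs (N + 1) unitInterval.zero_mem).2
    rw [abs_div, abs_of_pos hlam', div_le_iff₀ hlam']
    rw [div_le_iff₀ hlam'] at hb
    nlinarith
  have h2 : |g 0| ≤ M := hg 0 unitInterval.zero_mem
  calc |(cfTransfer A s)^[N + 1] g 0 / cfEig A s ^ (N + 1) - g 0|
      ≤ |(cfTransfer A s)^[N + 1] g 0 / cfEig A s ^ (N + 1)| + |g 0| := abs_sub _ _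
    _ ≤ (4 : ℝ) ^ s * M + M := add_le_add h1 h2
    _ = ((4 : ℝ) ^ s + 1) * M := by ring

/-- **The eigen-relation for the generalised limit:** `LIM cfAvg (L_s g) = λ LIM cfAvg g` for
`|g| ≤ M` on `[0,1]` and `L_s g` bounded on `[0,1]`. [folklore] -/
theorem cfUlim_cfAvg_cfTransfer (hne : A.Nonempty) {s : ℝ} (hs : 0 ≤ s) {g : ℝ → ℝ} {M : ℝ}
    (hg : ∀ y ∈ Icc (0 : ℝ) 1, |g y| ≤ M) :
    cfUlim (cfAvg A s (cfTransfer A s g)) = cfEig A s * cfUlim (cfAvg A s g) := by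
  have hb : ∀ N, |cfAvg A s g N| ≤ (4 : ℝ) ^ s * M := abs_cfAvg_le hA hne hs hg
  have hmain := (tendsto_cfUlim hb).const_mul (cfEig A s)
  -- the defect tends to `0` along `atTop`, hence along the hyperfilter
  have hdef : Tendsto (fun N => cfAvg A s (cfTransfer A s g) N - cfEig A s * cfAvg A s g N)
      (hyperfilter ℕ : Filter ℕ) (𝓝 0) := by
    refine Tendsto.mono_left ?_ Nat.hyperfilter_le_atTop
    refine squeeze_zero_norm (a := fun N : ℕ => cfEig A s * (((4 : ℝ) ^ s + 1) * M) / ((N : ℝ) + 1))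
      (fun N => ?_) ?_
    · rw [Real.norm_eq_abs]
      exact abs_cfAvg_cfTransfer_sub_le hA hne hs hg N
    · have hφ : Tendsto (fun N : ℕ => (N : ℝ) + 1) atTop atTop :=
        tendsto_natCast_atTop_atTop.atTop_add tendsto_const_nhds
      have h : Tendsto (fun N : ℕ => cfEig A s * (((4 : ℝ) ^ s + 1) * M) / ((N : ℝ) + 1)) atTop (𝓝 0) :=
        tendsto_const_nhds.div_atTop hφ
      exact h
  have := hdef.add hmain
  simp only [sub_add_cancel, zero_add] at this
  exact cfUlim_eq_of_tendsto this

end Avg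

/-! ### Continuous functions on `[0,1]` and the Riesz–Markov–Kakutani representation -/

/-- Extension of a continuous function on `[0,1]` to `ℝ` (constant outside). [folklore] -/
def cfExtend (f : C(Icc (0 : ℝ) 1, ℝ)) : ℝ → ℝ := Set.IccExtend zero_le_one f

/-- The extension agrees with the function on `[0,1]`. [folklore] -/
theorem cfExtend_of_mem (f : C(Icc (0 : ℝ) 1, ℝ)) {x : ℝ} (hx : x ∈ Icc (0 : ℝ) 1) :
    cfExtend f x = f ⟨x, hx⟩ := Set.IccExtend_of_mem _ _ hx

/-- The extension is bounded by the sup norm. [folklore] -/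
theorem abs_cfExtend_le (f : C(Icc (0 : ℝ) 1, ℝ)) (x : ℝ) : |cfExtend f x| ≤ ‖f‖ := by
  rw [cfExtend, Set.IccExtend_apply]
  exact (Real.norm_eq_abs _).symm.le.trans (f.norm_coe_le_norm _)

/-- The transfer operator on `C([0,1])`. [cite: MageeOhWinter2019, §2.2] -/
def cfTransferC (A : Finset ℕ) (hA : ∀ a ∈ A, 1 ≤ a) (s : ℝ) (f : C(Icc (0 : ℝ) 1, ℝ)) :
    C(Icc (0 : ℝ) 1, ℝ) where
  toFun x := cfTransfer A s (cfExtend f) x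
  continuous_toFun := by
    simp only [cfTransfer]
    refine continuous_finsetSum _ fun a ha => ?_
    have ha1 : (1 : ℝ) ≤ a := by exact_mod_cast hA a ha
    have hden : Continuous fun x : Icc (0 : ℝ) 1 => (x : ℝ) + a := continuous_subtype_val.add continuous_const
    have hpos : ∀ x : Icc (0 : ℝ) 1, (0 : ℝ) < (x : ℝ) + a := fun x => by linarith [x.2.1]
    refine Continuous.mul ?_ ?_
    · exact (hden.pow 2).rpow_const fun x => Or.inl (pow_pos (hpos x) 2).ne'
    · have hext : Continuous (cfExtend f) := f.continuous.Icc_extend'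
      exact hext.comp (continuous_const.div hden fun x => (hpos x).ne')

/-- Pointwise formula for the transfer operator on `C([0,1])`. [folklore] -/
theorem cfTransferC_apply (hA : ∀ a ∈ A, 1 ≤ a) (s : ℝ) (f : C(Icc (0 : ℝ) 1, ℝ)) (x : Icc (0 : ℝ) 1) :
    cfTransferC A hA s f x = cfTransfer A s (cfExtend f) x := rfl

section RMK

variable (hA : ∀ a ∈ A, 1 ≤ a)
include hA

/-- **Existence of an eigenmeasure of the transfer operator** ([MageeOhWinter2019, Thm. 10 (1)],
existence part, for `Γ_A`, on the unit interval): for `s ≥ 0` there is a nonzero finite measure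
`ν` on `[0,1]` with `∫ L_s f dν = e^{P_A(s)} ∫ f dν` for every `f ∈ C([0,1])`.
[cite: MageeOhWinter2019, Thm. 10] -/
theorem exists_cfTransfer_eigenmeasure (hne : A.Nonempty) {s : ℝ} (hs : 0 ≤ s) :
    ∃ ν : Measure (Icc (0 : ℝ) 1), IsFiniteMeasure ν ∧ ν univ ≠ 0 ∧
      ∀ f : C(Icc (0 : ℝ) 1, ℝ),
        ∫ x, cfTransferC A hA s f x ∂ν = cfEig A s * ∫ x, f x ∂ν := by
  -- the functional `Λ₀ f = LIM cfAvg (cfExtend f)`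
  let Λ₀ : C(Icc (0 : ℝ) 1, ℝ) → ℝ := fun f => cfUlim (cfAvg A s (cfExtend f))
  have hbd : ∀ f : C(Icc (0 : ℝ) 1, ℝ), ∀ y ∈ Icc (0 : ℝ) 1, |cfExtend f y| ≤ ‖f‖ :=
    fun f y _ => abs_cfExtend_le f y
  have hbA : ∀ f : C(Icc (0 : ℝ) 1, ℝ), ∀ N, |cfAvg A s (cfExtend f) N| ≤ (4 : ℝ) ^ s * ‖f‖ :=
    fun f => abs_cfAvg_le hA hne hs (hbd f)
  have hadd : ∀ f g : C(Icc (0 : ℝ) 1, ℝ), Λ₀ (f + g) = Λ₀ f + Λ₀ g := by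
    intro f g
    show cfUlim (cfAvg A s (cfExtend (f + g))) = _
    have h : cfAvg A s (cfExtend (f + g)) = fun N => cfAvg A s (cfExtend f) N + cfAvg A s (cfExtend g) N := by
      funext N
      rw [← cfAvg_add hA]
      refine cfAvg_congr hA s (fun y hy => ?_) N
      simp [cfExtend_of_mem _ hy]
    rw [h, cfUlim_add (hbA f) (hbA g)]
  have hsmul : ∀ (c : ℝ) (f : C(Icc (0 : ℝ) 1, ℝ)), Λ₀ (c • f) = c * Λ₀ f := by
    intro c f
    show cfUlim (cfAvg A s (cfExtend (c • f))) = _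
    have h : cfAvg A s (cfExtend (c • f)) = fun N => c * cfAvg A s (cfExtend f) N := by
      funext N
      rw [← cfAvg_const_mul hA]
      refine cfAvg_congr hA s (fun y hy => ?_) N
      simp [cfExtend_of_mem _ hy]
    rw [h, cfUlim_const_mul (hbA f)]
  have hmono : ∀ f g : C(Icc (0 : ℝ) 1, ℝ), f ≤ g → Λ₀ f ≤ Λ₀ g := by
    intro f g hfg
    have hdiff : Λ₀ g = Λ₀ f + Λ₀ (g - f) := by rw [← hadd]; simp
    have hnn : 0 ≤ Λ₀ (g - f) := by
      show 0 ≤ cfUlim (cfAvg A s (cfExtend (g - f)))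
      refine le_cfUlim (hbA (g - f)) fun N => cfAvg_nonneg hA s (fun y hy => ?_) N
      rw [cfExtend_of_mem _ hy]
      simpa using hfg ⟨y, hy⟩
    linarith
  -- the eigen-relation and the normalisation
  have heig : ∀ f : C(Icc (0 : ℝ) 1, ℝ), Λ₀ (cfTransferC A hA s f) = cfEig A s * Λ₀ f := by
    intro f
    show cfUlim (cfAvg A s (cfExtend (cfTransferC A hA s f))) = cfEig A s * cfUlim (cfAvg A s (cfExtend f))
    have h : cfAvg A s (cfExtend (cfTransferC A hA s f)) = cfAvg A s (cfTransfer A s (cfExtend f)) := by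
      funext N
      exact cfAvg_congr hA s (fun y hy => by rw [cfExtend_of_mem _ hy]; rfl) N
    rw [h, cfUlim_cfAvg_cfTransfer hA hne hs (hbd f)]
  have hone : (4 : ℝ) ^ (-s) ≤ Λ₀ 1 := by
    show (4 : ℝ) ^ (-s) ≤ cfUlim (cfAvg A s (cfExtend 1))
    have h : cfAvg A s (cfExtend 1) = cfAvg A s (fun _ => 1) := by
      funext N
      exact cfAvg_congr hA s (fun y hy => by rw [cfExtend_of_mem _ hy]; rfl) N
    rw [h]
    have hb1 : ∀ N, |cfAvg A s (fun _ => (1 : ℝ)) N| ≤ (4 : ℝ) ^ s * 1 :=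
      abs_cfAvg_le hA hne hs (fun y _ => by simp)
    exact le_cfUlim hb1 (le_cfAvg_one hA hne hs)
  -- Riesz–Markov–Kakutani
  let Λ : C_c(Icc (0 : ℝ) 1, ℝ) →ₚ[ℝ] ℝ :=
    { toFun := fun g => Λ₀ g.toContinuousMap
      map_add' := fun g g' => hadd _ _
      map_smul' := fun c g => hsmul c _
      monotone' := fun g g' hgg' => hmono _ _ fun x => hgg' x }
  refine ⟨RealRMK.rieszMeasure Λ, by infer_instance, ?_, fun f => ?_⟩
  · -- `ν univ ≥ Λ 1 ≥ 4^{-s} > 0`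
    intro h0
    let o : C_c(Icc (0 : ℝ) 1, ℝ) := ⟨1, HasCompactSupport.of_compactSpace _⟩
    have hint : ∫ x, o x ∂(RealRMK.rieszMeasure Λ) = Λ o := RealRMK.integral_rieszMeasure Λ o
    have hzero : ∫ x, o x ∂(RealRMK.rieszMeasure Λ) = 0 := by
      have : RealRMK.rieszMeasure Λ = 0 := Measure.measure_univ_eq_zero.1 h0
      rw [this, integral_zero_measure]
    have hΛo : Λ o = Λ₀ 1 := rfl
    have h4 : (0 : ℝ) < (4 : ℝ) ^ (-s) := Real.rpow_pos_of_pos (by norm_num) _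
    linarith [hint.symm.trans hzero ▸ hΛo ▸ hone]
  · let fc : C_c(Icc (0 : ℝ) 1, ℝ) := ⟨f, HasCompactSupport.of_compactSpace _⟩
    let Lfc : C_c(Icc (0 : ℝ) 1, ℝ) := ⟨cfTransferC A hA s f, HasCompactSupport.of_compactSpace _⟩
    have h1 : ∫ x, cfTransferC A hA s f x ∂(RealRMK.rieszMeasure Λ) = Λ Lfc :=
      RealRMK.integral_rieszMeasure Λ Lfc
    have h2 : ∫ x, f x ∂(RealRMK.rieszMeasure Λ) = Λ fc := RealRMK.integral_rieszMeasure Λ fc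
    rw [h1, h2]
    exact heig f

end RMK

end Literature.NumberTheory.Sieve
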